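import Mathlib
import Summits.RiemannHypothesis.RiemannHypothesis.Theorems.WeilFormatCCellShiftCertA10397p4
import Summits.RiemannHypothesis.RiemannHypothesis.Theorems.WeilFormatCCellShiftCertA10397p4T
import Summits.RiemannHypothesis.RiemannHypothesis.Theorems.WeilFormatCCellShiftCertRange
import HarnessLib

/-!
# Kernel class parts 4–5 of the cell-refined shift certificate `cellA10397p4`

Helper file (`--supports stmt-RiemannHypothesis-0098`), RH-free; seat rh-explicit-weil-1 gen3.  One `decide +kernel` pair pass
per class part of `CellSOS.cellA10397p4` (`WeilFormatCCellShiftCertA10397p4.lean`); consumed by the bound file together with `cellA10397p4_check`.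
-/

set_option linter.dupNamespace false

namespace Summit.RiemannHypothesis.RiemannHypothesis.Theorems.WeilFormatC.CellSOS

set_option maxHeartbeats 0 in
set_option maxRecDepth 100000 in
/-- Row-range part 4 of `cellA10397p4`: the kernel's partial class table IS the claimed one. [folklore] -/
theorem cellA10397p4_tabR4 : cellA10397p4.checkTab cellA10397p4T 4 = true := by
  decide +kernel

set_option maxHeartbeats 0 in
set_option maxRecDepth 100000 in
/-- Row-range part 5 of `cellA10397p4`: the kernel's partial class table IS the claimed one. [folklore] -/
theorem cellA10397p4_tabR5 : cellA10397p4.checkTab cellA10397p4T 5 = true := by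
  decide +kernel

end Summit.RiemannHypothesis.RiemannHypothesis.Theorems.WeilFormatC.CellSOS
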